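import Mathlib

/-!
# Shape diversity of ladders, right side — one packing certificate (support file, siege k12)

Item `stmt-MatrixMultiplication-14308` (`FourierTwoFamiliesModP.PrimeTwoFamilies`, CKSU 2005 Conj. 4.7 with
prime cyclic hosts), line `Sketch`, registered stub `ladder_rpow_le_rightShapes` (best-of-24 siege, attempt
k12, variation "certificate / decide on the finite core").

A LADDER in an additive commutative group `G` is an ordered family `(X c, Y c)_{c < r}` of finite subsets with

* (`hW`, directness) `(x - x') + (y - y') = 0 → x = x' ∧ y = y'` for `x, x' ∈ X c`, `y, y' ∈ Y c`;
* (`hL`, one-directional separation) for `p < q` no lower cross difference `y' - x'` (`x' ∈ X p`,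
  `y' ∈ Y q`) equals a diagonal difference `y - x` (`x ∈ X c`, `y ∈ Y c`, any class `c`).

THE STUB.  A ladder level of the cyclic ladder conjecture's slice `ε` in `ZMod m` — `m^{1/2-ε} ≤ r`
classes, co-volumes `m^{1-ε} ≤ |X c|·|Y c|` — whose `Y`-sides are translates `u c +ᵥ Y₀ (κ c)` of `K`
templates satisfies `m^{1/2-2ε} ≤ K`.

DESIGN ("certificate on the finite core").  The statement splits into an exponent-free FINITE CORE and
two `rpow` identities.  The finite core is certified by ONE explicit map, with no fibrewise bookkeeping:

  `Φ : (c, x, b) ↦ (κ c, x + b)`,  `(Σ_{c < r} X c × Y₀ (κ c)) → Fin K × G`.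

`Φ` is injective (`packingCert_injOn`): a collision has `κ i = κ k` and `x + b = x' + b'` with `x ∈ X i`,
`x' ∈ X k`, `b, b' ∈ Y₀ (κ k)`; read in class `k` it says that the diagonal difference `(u k + b) - x'`
equals the cross difference `(u k + b') - x` between `X i` and `Y k`, which `hL (k, i, k)` forbids when
`i < k`; read in class `i` it is forbidden by `hL (i, k, i)` when `k < i`; and for `i = k` directness gives
`x = x'`, `b = b'`.  Counting the image inside `Fin K × G` gives the finite core
`Σ_c |X c|·|Y₀ (κ c)| ≤ K·|G|` (`sum_card_mul_card_le_mul_card_of_subshapes`), which only needs the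
CONTAINMENTS `u c +ᵥ Y₀ (κ c) ⊆ Y c` (so it covers at once the one-template/sub-pattern and the
`K`-template/exact-translate packings of the line).  The stub is then `m^{1/2-ε}·m^{1-ε} ≤ r·m^{1-ε} ≤
Σ_c |X c|·|Y c| ≤ K·m` and `m^{1/2-ε}·m^{1-ε} = m^{1/2-2ε}·m`.  The constant in the finite core is
sharp: a kernel-decided two-class instance in `ZMod 4` with one template attains equality (end of file).

An earlier proof of the same registered stub (fibrewise, via `Finset.sum_fiberwise` and the one-template
packing) is `…Theorems.PrimeTwoFamilies.LadderLift.ladder_rpow_le_rightShapes`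
(`FourierTwoFamiliesModPPrimeTwoFamiliesShapeDiversity.lean`); this file is self-contained (Mathlib only)
and lives in its own siege namespace.
-/

-- single-conjunct summit: the mandated namespace repeats `MatrixMultiplication` (summit = sub-problem).
set_option linter.dupNamespace false

namespace Summit.MatrixMultiplication.MatrixMultiplication.Theorems.PrimeTwoFamilies.LadderRightShapesCertK12

open scoped Pointwise

/-- **The packing certificate is injective.**  For a ladder `(X c, Y c)_{c<r}` in `G` whose `Y`-sides
contain the translates `u c +ᵥ Y₀ (κ c)` of templates `Y₀ 0, …, Y₀ (K-1)`, the map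
`(c, x, b) ↦ (κ c, x + b)` is injective on `Σ_c X c × Y₀ (κ c)`. -/
theorem packingCert_injOn {G : Type*} [AddCommGroup G] [DecidableEq G] {r K : ℕ}
    (X Y : Fin r → Finset G)
    (hW : ∀ c : Fin r, ∀ x ∈ X c, ∀ x' ∈ X c, ∀ y ∈ Y c, ∀ y' ∈ Y c,
      (x - x') + (y - y') = 0 → x = x' ∧ y = y')
    (hL : ∀ c p q : Fin r, p < q → ∀ x ∈ X c, ∀ y ∈ Y c, ∀ x' ∈ X p, ∀ y' ∈ Y q, y - x ≠ y' - x')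
    (Y₀ : Fin K → Finset G) (κ : Fin r → Fin K) (u : Fin r → G)
    (hY : ∀ c, u c +ᵥ Y₀ (κ c) ⊆ Y c) :
    Set.InjOn (fun z : (Σ _ : Fin r, G × G) => (κ z.1, z.2.1 + z.2.2))
      ↑(Finset.univ.sigma fun c => X c ×ˢ Y₀ (κ c)) := by
  -- membership of the shifted template points in the `Y`-sides
  have memY : ∀ c, ∀ b ∈ Y₀ (κ c), u c + b ∈ Y c := fun c b hb =>
    hY c (Finset.mem_vadd_finset.2 ⟨b, hb, rfl⟩)
  rintro ⟨i, a, b⟩ hx ⟨k, a', b'⟩ hy hxy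
  simp only [Finset.coe_sigma, Set.mem_sigma_iff, Finset.coe_univ, Set.mem_univ, true_and,
    Finset.mem_coe, Finset.mem_product] at hx hy
  obtain ⟨ha, hb⟩ := hx
  obtain ⟨ha', hb'⟩ := hy
  simp only [Prod.mk.injEq] at hxy
  obtain ⟨hκ, hab⟩ := hxy
  -- the collision `a + b = a' + b'`, read as an equality of differences in class `k` / class `i`
  have e₁ : ∀ v : G, (v + b) - a' - ((v + b') - a) = (a + b) - (a' + b') := fun v => by abel
  have e₂ : ∀ v : G, (v + b') - a - ((v + b) - a') = -((a + b) - (a' + b')) := fun v => by abel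
  rcases lt_trichotomy i k with hik | rfl | hki
  · -- `i < k`: diagonal pair `(a', u k + b)` of class `k` against the cross pair `(a, u k + b')`
    rw [hκ] at hb
    exact (hL k i k hik a' ha' (u k + b) (memY k b hb) a ha (u k + b') (memY k b' hb')
      (sub_eq_zero.1 (by rw [e₁, hab, sub_self]))).elim
  · -- `i = k`: directness of the class
    have e : ∀ v : G, a - a' + (v + b - (v + b')) = (a + b) - (a' + b') := fun v => by abel
    obtain ⟨h1, h2⟩ := hW i a ha a' ha' (u i + b) (memY i b hb) (u i + b') (memY i b' hb')
      (by rw [e, hab, sub_self])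
    have hb2 : b = b' := add_left_cancel h2
    subst h1 hb2
    rfl
  · -- `k < i`: diagonal pair `(a, u i + b')` of class `i` against the cross pair `(a', u i + b)`
    rw [← hκ] at hb'
    exact (hL i k i hki a ha (u i + b') (memY i b' hb') a' ha' (u i + b) (memY i b hb)
      (sub_eq_zero.1 (by rw [e₂, hab, sub_self, neg_zero]))).elim

/-- **Finite core: `K` right sub-shapes pack `K` times.**  If the `Y`-sides of a ladder contain the
translates `u c +ᵥ Y₀ (κ c)` of `K` templates, then `Σ_c |X c|·|Y₀ (κ c)| ≤ K·|G|`: count the image of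
the injective certificate `(c, x, b) ↦ (κ c, x + b)` inside `Fin K × G`. -/
theorem sum_card_mul_card_le_mul_card_of_subshapes {G : Type*} [AddCommGroup G] [Fintype G]
    [DecidableEq G] {r K : ℕ} (X Y : Fin r → Finset G)
    (hW : ∀ c : Fin r, ∀ x ∈ X c, ∀ x' ∈ X c, ∀ y ∈ Y c, ∀ y' ∈ Y c,
      (x - x') + (y - y') = 0 → x = x' ∧ y = y')
    (hL : ∀ c p q : Fin r, p < q → ∀ x ∈ X c, ∀ y ∈ Y c, ∀ x' ∈ X p, ∀ y' ∈ Y q, y - x ≠ y' - x')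
    (Y₀ : Fin K → Finset G) (κ : Fin r → Fin K) (u : Fin r → G)
    (hY : ∀ c, u c +ᵥ Y₀ (κ c) ⊆ Y c) :
    ∑ c, (X c).card * (Y₀ (κ c)).card ≤ K * Fintype.card G := by
  have h := Finset.card_le_card_of_injOn (t := (Finset.univ : Finset (Fin K × G)))
    (fun z : (Σ _ : Fin r, G × G) => (κ z.1, z.2.1 + z.2.2)) (fun _ _ => Finset.mem_univ _)
    (packingCert_injOn X Y hW hL Y₀ κ u hY)
  rw [Finset.card_sigma, Finset.card_univ, Fintype.card_prod, Fintype.card_fin] at h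
  calc ∑ c, (X c).card * (Y₀ (κ c)).card = ∑ c, (X c ×ˢ Y₀ (κ c)).card :=
        Finset.sum_congr rfl fun c _ => (Finset.card_product _ _).symm
    _ ≤ K * Fintype.card G := h

/-- **Shape diversity, right side** (registered stub `ladder_rpow_le_rightShapes`).  A ladder level of
the cyclic ladder conjecture's slice `ε` in `ZMod m` — `m^{1/2-ε} ≤ r` classes, co-volumes
`m^{1-ε} ≤ |X c|·|Y c|` — whose `Y`-sides are translates of `K` templates has `m^{1/2-2ε} ≤ K`:
the finite core gives `m^{1/2-ε}·m^{1-ε} ≤ r·m^{1-ε} ≤ Σ_c |X c|·|Y c| ≤ K·m`, and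
`m^{1/2-ε}·m^{1-ε} = m^{1/2-2ε}·m`. -/
theorem ladder_rpow_le_rightShapes {m : ℕ} [NeZero m] {r K : ℕ} (X Y : Fin r → Finset (ZMod m))
    (hW : ∀ c : Fin r, ∀ x ∈ X c, ∀ x' ∈ X c, ∀ y ∈ Y c, ∀ y' ∈ Y c,
      (x - x') + (y - y') = 0 → x = x' ∧ y = y')
    (hL : ∀ c p q : Fin r, p < q → ∀ x ∈ X c, ∀ y ∈ Y c, ∀ x' ∈ X p, ∀ y' ∈ Y q, y - x ≠ y' - x')
    (Y₀ : Fin K → Finset (ZMod m)) (κ : Fin r → Fin K) (u : Fin r → ZMod m)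
    (hY : ∀ c, Y c = u c +ᵥ Y₀ (κ c))
    {ε : ℝ} (hr : (m : ℝ) ^ (1 / 2 - ε) ≤ (r : ℝ))
    (hP : ∀ c : Fin r, (m : ℝ) ^ (1 - ε) ≤ (((X c).card * (Y c).card : ℕ) : ℝ)) :
    (m : ℝ) ^ (1 / 2 - 2 * ε) ≤ (K : ℝ) := by
  have hm0 : (0 : ℝ) < m := Nat.cast_pos.2 (Nat.pos_of_ne_zero (NeZero.ne m))
  -- the finite core (exact translates are in particular sub-shapes), with `|Y c| = |Y₀ (κ c)|`
  have hcore : ∑ c, (X c).card * (Y c).card ≤ K * m := by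
    have h :=
      sum_card_mul_card_le_mul_card_of_subshapes X Y hW hL Y₀ κ u fun c => (hY c).symm.subset
    rw [ZMod.card] at h
    calc ∑ c, (X c).card * (Y c).card = ∑ c, (X c).card * (Y₀ (κ c)).card :=
          Finset.sum_congr rfl fun c _ => by rw [hY c, Finset.card_vadd_finset]
      _ ≤ K * m := h
  -- sum the slice bounds over the classes and compare with the core
  have hslice : (m : ℝ) ^ (1 / 2 - ε) * (m : ℝ) ^ (1 - ε) ≤ (K : ℝ) * m :=
    calc (m : ℝ) ^ (1 / 2 - ε) * (m : ℝ) ^ (1 - ε)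
        ≤ (r : ℝ) * (m : ℝ) ^ (1 - ε) := mul_le_mul_of_nonneg_right hr (Real.rpow_nonneg hm0.le _)
      _ = ∑ _c : Fin r, (m : ℝ) ^ (1 - ε) := by
          rw [Finset.sum_const, Finset.card_univ, Fintype.card_fin, nsmul_eq_mul]
      _ ≤ ∑ c : Fin r, (((X c).card * (Y c).card : ℕ) : ℝ) := Finset.sum_le_sum fun c _ => hP c
      _ ≤ (K : ℝ) * m := by exact_mod_cast (Nat.cast_sum _ _).symm.le.trans (Nat.cast_le.2 hcore)
  -- exponent bookkeeping: `m^{1/2-ε}·m^{1-ε} = m^{1/2-2ε}·m`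
  have hexp : (m : ℝ) ^ (1 / 2 - 2 * ε) * m = (m : ℝ) ^ (1 / 2 - ε) * (m : ℝ) ^ (1 - ε) := by
    rw [← Real.rpow_add hm0, ← Real.rpow_add_one hm0.ne']
    congr 1
    ring
  exact le_of_mul_le_mul_right (hexp ▸ hslice) hm0

/-- **The finite core is sharp (kernel-decided certificate).**  In `ZMod 4` the two-class ladder
`X = ({0}, {1})`, `Y = ({1, 3}, {0, 2})` — both `Y`-sides translates (`u = (1, 0)`) of the single
template `Y₀ 0 = {0, 2}`, so `K = 1` — satisfies `hW`, `hL`, `hY` of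
`sum_card_mul_card_le_mul_card_of_subshapes` and attains `Σ_c |X c|·|Y₀ (κ c)| = 4 = K·|ZMod 4|`;
each clause is a closed decidable proposition checked by `decide`. -/
example :
    (∀ c : Fin 2, ∀ x ∈ (![{0}, {1}] : Fin 2 → Finset (ZMod 4)) c,
        ∀ x' ∈ (![{0}, {1}] : Fin 2 → Finset (ZMod 4)) c,
        ∀ y ∈ (![{1, 3}, {0, 2}] : Fin 2 → Finset (ZMod 4)) c,
        ∀ y' ∈ (![{1, 3}, {0, 2}] : Fin 2 → Finset (ZMod 4)) c,
        (x - x') + (y - y') = 0 → x = x' ∧ y = y') ∧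
      (∀ c p q : Fin 2, p < q → ∀ x ∈ (![{0}, {1}] : Fin 2 → Finset (ZMod 4)) c,
        ∀ y ∈ (![{1, 3}, {0, 2}] : Fin 2 → Finset (ZMod 4)) c,
        ∀ x' ∈ (![{0}, {1}] : Fin 2 → Finset (ZMod 4)) p,
        ∀ y' ∈ (![{1, 3}, {0, 2}] : Fin 2 → Finset (ZMod 4)) q, y - x ≠ y' - x') ∧
      (∀ c : Fin 2,
        (![1, 0] : Fin 2 → ZMod 4) c +ᵥ (![{0, 2}] : Fin 1 → Finset (ZMod 4)) ((fun _ => 0) c) ⊆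
          (![{1, 3}, {0, 2}] : Fin 2 → Finset (ZMod 4)) c) ∧
      ∑ c : Fin 2, ((![{0}, {1}] : Fin 2 → Finset (ZMod 4)) c).card *
          ((![{0, 2}] : Fin 1 → Finset (ZMod 4)) ((fun _ => 0) c)).card =
        1 * Fintype.card (ZMod 4) :=
  ⟨by decide, by decide, by decide, by decide⟩

end Summit.MatrixMultiplication.MatrixMultiplication.Theorems.PrimeTwoFamilies.LadderRightShapesCertK12
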